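import Summits.QuantumFields.BalabanUV.Beta.GAN24.FineReadoutAliasFold
import Summits.QuantumFields.BalabanUV.Beta.GAN24.FineReadoutApriori
import Summits.QuantumFields.BalabanUV.Beta.GAN24.AliasPointSum
import Summits.QuantumFields.BalabanUV.Beta.GAN24.AliasFibreBridge

/-!
# `BalabanUV.Beta.GAN24.FineReadoutSum` — binder row G-an2-4 / (CONV-C), S-slot located remainder «E3Shape», route «S3-fibre²»
# (gan24-p1 `SKELETON-S3.md` v0.3 §8, RATIFIED method of record for S3-L1∕(S3-1) = «(U2′) explicit-alias», node E3A3(c) of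
# `HOME/b2b-balaban-gan24-formalise-leaf-16/g8/E3A-READOUT.md` §2–§3): THE SUM — (U2′), the N-UNIFORM POINT-ENTRY BOUND OF THE MINIMISER COLUMN
# ON THE WHOLE STRIP, from (U1)+A BY NAME

NOT IN PRINT; OUR PROOF ATTEMPT (of the road; THIS file is [folklore] assembly: E3A3(a,b) `FineReadoutApriori.column_apriori` (zero alias + border from the
scaled a-priori pair), the arrow equations unpacked per alias (`ArrowOperator.arrowMat_ofSymbols_pack_eq_iff` + leaf-15's `CapacitanceSolve.block_unique`),
E3A2 `FineReadoutAlias.norm_Asol_border_le` on every alias `m ≠ 0`, the window-free King sum `AliasPointSum.sum_pointWeight_srep_le`, and the plane-wave factor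
`e^{(d+1)η}`).  HONEST FRAMING (cell contract, verbatim): «discharging `BetaPertH` makes Bałaban's UV stability UNCONDITIONAL — a real constructive-QFT result; it
is NOT the continuum limit and NOT the Clay problem.»  HONEST DEPENDENCY (verbatim): «continuum YM on T⁴ ⇐ BetaPertH ∧ nine spine estimates (0/9 proved); BetaPertH ⇐
(D1) ∧ (D4) ∧ CAP+tail; G-an2-4 gates asym, D1 and NE2/3/4.»  (U1)+A are HYPOTHESES here (theorems of road P1 at d = 3, `FibreDetStripHolds.exists_strip`); no cited
fact, no wall binder, no `def … : Prop`; discharges NOTHING of (hS, hSall) / «E3Shape»; NOT `BetaPertH`, NOT continuum, NOT Clay.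

## What is proved (generic `d`, `D = d+1`; block side `N`; complex `p` with `|Re p_i| ≤ π`, `|Im p_i| ≤ η`, `0 ≤ η ≤ 1/4`, `(3D/2+2)η ≤ 1/2`, `det F_N(p) ≠ 0`;
## radii `0 < r m`, `0 < r₀`; NO hypothesis on the zero alias's `L_0(p)` — only the blocks `m ≠ 0` (where `L_m ≠ 0` by F2) are ever solved explicitly)
* `norm_pw_repZ_le`: `‖pw (kFine p m) (repZ z)‖ ≤ e^{(d+1)η}` (intra-block plane wave on the strip).
* `ampA_eq_Asol`: at every alias with `L_m(p) ≠ 0` the amplitude of the minimiser column IS leaf-02's `Asol` with border feed, for the gauge constant of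
  `FineReadoutApriori.exists_arrow_column` (leaf-15's `block_homog` per block; no global `∀ m, L_m ≠ 0`).
* `pointWeight_neg_one_eq` / `pointWeight_neg_two_eq`: E3A2's folded weights are leaf-16's `AliasPointSum.pointWeight (−1)`, `pointWeight (−2)` at `srep m`.
* **`norm_fibInv_inl_inr_le`** — (U2′): `‖fibInv N (inl (κ, z)) (inr (inr l)) p‖ ≤ e^{(d+1)η} · A · (N^{d+2})⁻¹ · (1 + K_{d+1}·(r₀²·C₁ + r₀³·C₂))`,
  `K_D = √12^D·√6·(1+8D)` (E3A2), `C₁ = (3π)²·3^D·aliasConst D (−1)`, `C₂ = (3π)³·3^D·aliasConst D (−2)` (King (4.22)) — uniform in `N`, `p`, `κ`, `l`, `z`.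
Unit `b2b-balaban-gan24-formalise-leaf-16` (G-an2-4 formalisation swarm, leaf prover 16, gen 8; records — idle-seat engine), 2026-08-20.
-/

noncomputable section

open Complex Finset Matrix
open scoped BigOperators Real Matrix.Norms.L2Operator
open Literature.Probability.LatticeModels (TorusSite)
open Literature.MathematicalPhysics.QuantumFieldTheory.LatticeForm (repZ)
open Literature.MathematicalPhysics.QuantumFieldTheory.Balaban1983to89
open Literature.MathematicalPhysics.QuantumFieldTheory.Balaban1983to89.Beta
open Literature.MathematicalPhysics.QuantumFieldTheory.King1986 (aliasConst)
open B4Strip (reVec)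
open BlochFibreMatrix (Idx stencil pieceMatrix)
open FibreInverseDecay (trigPolySymbol)
open Summit.QuantumFields.BalabanUV.Beta.GAN24.FibreSymbols (pw lapSym dhat dflat)
open Summit.QuantumFields.BalabanUV.Beta.GAN24.FibreBlockSolve (dot Asol musol EL_row_Asol G_row_Asol)
open Summit.QuantumFields.BalabanUV.Beta.GAN24.FibreDFT (kFine)
open Summit.QuantumFields.BalabanUV.Beta.GAN24.FibreDFTDictionary (ampA ampμ boxData_inl_eq_sum)
open Summit.QuantumFields.BalabanUV.Beta.GAN24.FibreArrow (chiHat sflat dot_dflat_dhat)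
open Summit.QuantumFields.BalabanUV.Beta.GAN24.CapacitanceSolve (block_homog)
open Summit.QuantumFields.BalabanUV.Beta.GAN24.AliasObjects (kAl chiAl sbAl dAl dbAl LAl)
open Summit.QuantumFields.BalabanUV.Beta.GAN24.AliasFibreBridge (chiHat_eq_chiAl sflat_eq_sbAl)
open Summit.QuantumFields.BalabanUV.Beta.GAN24.AliasReindex (srep)
open Summit.QuantumFields.BalabanUV.Beta.GAN24.ArrowOperator (AIdx Loc arrowMat aliasArrow pack ofSymbols arrowMat_ofSymbols_pack_eq_iff)
open Summit.QuantumFields.BalabanUV.Beta.GAN24.ArrowScaling (scaledArrow)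
open Summit.QuantumFields.BalabanUV.Beta.GAN24.StripAliasWeights (norm_cexp_offset_eq)
open Summit.QuantumFields.BalabanUV.Beta.GAN24.CombesThomasFibre (fibInv)
open Summit.QuantumFields.BalabanUV.Beta.GAN24.AliasPointSum (realVec pointWeight sum_pointWeight_srep_le)
open Summit.QuantumFields.BalabanUV.Beta.GAN24.FineReadoutAlias (wfold Fsup wfold_nonneg one_le_Fsup norm_Asol_border_le)
open Summit.QuantumFields.BalabanUV.Beta.GAN24.FineReadoutApriori (column_apriori)

namespace Summit.QuantumFields.BalabanUV.Beta.GAN24.FineReadoutSum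

variable {d N : ℕ} [NeZero N] {p : Fin (d + 1) → ℂ} {η : ℝ}

/-! ## §1 The intra-block plane wave on the strip -/

/-- [folklore] The box representative has coordinates in `[0, N)`: `|repZ z i| ≤ N`. -/
theorem abs_repZ_le (z : TorusSite (d + 1) N) (i : Fin (d + 1)) : |((repZ z i : ℤ) : ℝ)| ≤ N := by
  have h : (repZ z i : ℤ) = ((z i).val : ℤ) := rfl
  rw [h, Int.cast_natCast, abs_of_nonneg (Nat.cast_nonneg _)]
  exact_mod_cast (ZMod.val_lt (z i)).le

/-- [folklore] **THE PLANE-WAVE FACTOR ON THE STRIP**: `‖pw (kFine p m) (repZ z)‖ ≤ e^{(d+1)η}` for `|Im p_i| ≤ η` (the fine momentum has imaginary part `Im p/N`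
and the box representative has coordinates `< N`). -/
theorem norm_pw_repZ_le (him : ∀ i, |(p i).im| ≤ η) (m : TorusSite (d + 1) N) (z : TorusSite (d + 1) N) :
    ‖pw (kFine p m) (repZ z)‖ ≤ Real.exp ((d + 1) * η) := by
  have hN : (0 : ℝ) < N := by exact_mod_cast Nat.pos_of_ne_zero (NeZero.ne N)
  have e : pw (kFine p m) (repZ z) = cexp (I * ∑ i, kAl N p m i * (((1 : ℕ) : ℂ) * (repZ z i : ℂ))) := by
    unfold pw kAl; simp only [Nat.cast_one, one_mul]
  rw [e, norm_cexp_offset_eq]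
  apply Real.exp_le_exp.2
  simp only [Nat.cast_one, one_mul]
  calc -∑ i, (p i).im / N * ((repZ z i : ℤ) : ℝ) = ∑ i, (-((p i).im / N * ((repZ z i : ℤ) : ℝ))) := by rw [Finset.sum_neg_distrib]
    _ ≤ ∑ _i : Fin (d + 1), η := Finset.sum_le_sum fun i _ => by
        have h1 : |(p i).im / N * ((repZ z i : ℤ) : ℝ)| ≤ η / N * N := by
          rw [abs_mul, abs_div, abs_of_pos hN]
          exact mul_le_mul (div_le_div_of_nonneg_right (him i) hN.le) (abs_repZ_le z i) (abs_nonneg _)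
            (div_nonneg ((abs_nonneg _).trans (him i)) hN.le)
        rw [div_mul_cancel₀ _ hN.ne'] at h1
        linarith [neg_abs_le ((p i).im / N * ((repZ z i : ℤ) : ℝ)), abs_nonneg ((p i).im / N * ((repZ z i : ℤ) : ℝ))]
    _ = (d + 1) * η := by rw [Finset.sum_const, Finset.card_univ, Fintype.card_fin, nsmul_eq_mul]; push_cast; ring

/-! ## §2 The alias amplitudes of the column are `Asol` with border feed (for the gauge constant of the arrow equation) -/

/-- [folklore] **PER-BLOCK IDENTIFICATION, NO GLOBAL `L ≠ 0` HYPOTHESIS**: from the arrow equation of the column, at every alias `m` whose Laplacian symbol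
`L_m(p)` is nonzero the amplitude IS leaf-02's explicit block solution with border feed (leaf-15's `block_homog` on the difference; the zero set of `L_0` inside the
strip is never touched because only `m ≠ 0` is used downstream). -/
theorem ampA_eq_Asol {v : Idx (d + 1) N → ℂ} {φ : Fin (d + 1) → ℂ} {c : ℂ} {l : Fin (d + 1)}
    (hx : arrowMat (aliasArrow N p) *ᵥ pack (ampA p v) (ampμ p v) φ c
      = pack (0 : TorusSite (d + 1) N → Fin (d + 1) → ℂ) (0 : TorusSite (d + 1) N → ℂ) (Pi.single l (1 : ℂ)) 0)
    (m : TorusSite (d + 1) N) (hLm : lapSym (kFine p m) ≠ 0) :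
    ampA p v m = Asol (dAl N p m) (dbAl N p m) (fun κ => chiAl N p m * sbAl N p m κ * φ κ) (LAl N p m) (chiAl N p m * c) := by
  have h := (arrowMat_ofSymbols_pack_eq_iff _ _ _ _ _ _ _ _ _ _ _ _ _ _ _).mp hx
  -- the EL and G rows of block `m` (sources zero), in the `dAl/dbAl/LAl/chiAl/sbAl` dress
  set g : Fin (d + 1) → ℂ := fun κ => chiAl N p m * sbAl N p m κ * φ κ with hg
  set cc : ℂ := chiAl N p m * c with hcc
  have hEL : ∀ κ, 2 * (LAl N p m * ampA p v m κ - dAl N p m κ * dot (dbAl N p m) (ampA p v m)) - LAl N p m * dAl N p m κ * ampμ p v m - g κ = 0 := by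
    intro κ
    have e := h.1 m κ
    simp only [Pi.zero_apply, chiHat_eq_chiAl, sflat_eq_sbAl] at e
    rw [hg]
    show 2 * (lapSym (kFine p m) * ampA p v m κ - dhat (kFine p m) κ * dot (dflat (kFine p m)) (ampA p v m))
      - lapSym (kFine p m) * dhat (kFine p m) κ * ampμ p v m - chiAl N p m * sbAl N p m κ * φ κ = 0
    linear_combination e
  have hG : LAl N p m * dot (dbAl N p m) (ampA p v m) - cc = 0 := by
    have e := h.2.1 m
    simp only [Pi.zero_apply, chiHat_eq_chiAl] at e
    rw [hcc]
    exact e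
  -- the explicit solution satisfies the same rows
  have hLdef : dot (dbAl N p m) (dAl N p m) = LAl N p m := dot_dflat_dhat (kFine p m)
  have hEL' := EL_row_Asol (dAl N p m) (dbAl N p m) g hLm hLdef cc
  have hG' := G_row_Asol (dAl N p m) (dbAl N p m) g hLm hLdef cc
  -- the difference solves the homogeneous block
  set B : Fin (d + 1) → ℂ := ampA p v m - Asol (dAl N p m) (dbAl N p m) g (LAl N p m) cc with hB
  set ν : ℂ := ampμ p v m - musol (dbAl N p m) g (LAl N p m) with hν
  have hELB : ∀ κ, 2 * (LAl N p m * B κ - dAl N p m κ * dot (dbAl N p m) B) - LAl N p m * dAl N p m κ * ν = 0 := by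
    intro κ
    have e1 := hEL κ
    have e2 := hEL' κ
    rw [hB, hν, CapacitanceSolve.dot_sub_right, Pi.sub_apply]
    linear_combination e1 - e2
  have hGB : LAl N p m * dot (dbAl N p m) B = 0 := by
    rw [hB, CapacitanceSolve.dot_sub_right]
    linear_combination hG - hG'
  have h0 := (block_homog (dAl N p m) (dbAl N p m) B ν hLm hLdef hELB hGB).1
  rw [hB] at h0
  exact sub_eq_zero.1 h0

/-! ## §3 E3A2's folded weights are `pointWeight (−1)` / `pointWeight (−2)` at `srep m` -/

/-- [folklore] `(Fsup m)^2⁻¹ · Π wfold = pointWeight (−1) (srep m)` for `m ≠ 0`. -/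
theorem pointWeight_neg_one_eq {m : TorusSite (d + 1) N} (hm : m ≠ 0) :
    1 / Fsup m ^ 2 * ∏ i, wfold m i = pointWeight (-1) (srep m) := by
  have hF : 0 < Fsup m := lt_of_lt_of_le one_pos (one_le_Fsup hm)
  unfold pointWeight wfold Fsup realVec
  rw [show ((-1 : ℝ) - 1) = -((2 : ℕ) : ℝ) by norm_num, Real.rpow_neg (norm_nonneg _), Real.rpow_natCast, one_div]

/-- [folklore] `(Fsup m)^3⁻¹ · Π wfold = pointWeight (−2) (srep m)` for `m ≠ 0`. -/
theorem pointWeight_neg_two_eq {m : TorusSite (d + 1) N} (hm : m ≠ 0) :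
    1 / Fsup m ^ 3 * ∏ i, wfold m i = pointWeight (-2) (srep m) := by
  have hF : 0 < Fsup m := lt_of_lt_of_le one_pos (one_le_Fsup hm)
  unfold pointWeight wfold Fsup realVec
  rw [show ((-2 : ℝ) - 1) = -((3 : ℕ) : ℝ) by norm_num, Real.rpow_neg (norm_nonneg _), Real.rpow_natCast, one_div]

/-! ## §4 (U2′): the point-entry bound -/

/-- [folklore] **(U2′) — THE N-UNIFORM POINT-ENTRY BOUND OF THE MINIMISER COLUMN ON THE STRIP**, from (U1)+A (every strip point with `det ≠ 0`):
`‖fibInv N (inl (κ, z)) (inr (inr l)) p‖ ≤ e^{(d+1)η}·A·(N^{d+2})⁻¹·(1 + K_{d+1}·(r₀²·C₁ + r₀³·C₂))`. -/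
theorem norm_fibInv_inl_inr_le (hre : ∀ i, |(p i).re| ≤ π) (him : ∀ i, |(p i).im| ≤ η) (hη : 0 ≤ η) (hη4 : η ≤ 1 / 4)
    (hηD : (3 * (d + 1 : ℕ) / 2 + 2) * η ≤ 1 / 2)
    (hdet : (trigPolySymbol (stencil (d + 1)) (pieceMatrix (N := N)) p).det ≠ 0)
    {r : TorusSite (d + 1) N → ℝ} (hr : ∀ m, 0 < r m) {r0 : ℝ} (hr0 : 0 < r0) {A : ℝ} (hA0 : 0 ≤ A)
    (hU : IsUnit (arrowMat (scaledArrow N r r0 p))) (hA : ‖(arrowMat (scaledArrow N r r0 p))⁻¹‖ ≤ A)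
    (l κ : Fin (d + 1)) (z : TorusSite (d + 1) N) :
    ‖fibInv N (Sum.inl (κ, z)) (Sum.inr (Sum.inr l)) p‖
      ≤ Real.exp ((d + 1) * η) * A * ((N : ℝ) ^ (d + 1 + 1))⁻¹ *
          (1 + (Real.sqrt 12 ^ (d + 1) * (Real.sqrt 6 * (1 + 8 * (d + 1 : ℕ)))) *
            (r0 ^ 2 * ((3 * π) ^ (1 - (-1 : ℝ)) * (3 : ℝ) ^ (d + 1) * aliasConst (d + 1) (-1))
              + r0 ^ 3 * ((3 * π) ^ (1 - (-2 : ℝ)) * (3 : ℝ) ^ (d + 1) * aliasConst (d + 1) (-2)))) := by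
  classical
  -- notation
  set v : Idx (d + 1) N → ℂ := fun i => fibInv N i (Sum.inr (Sum.inr l)) p with hv
  set B : ℝ := A * ((N : ℝ) ^ (d + 1 + 1))⁻¹ with hB
  set K : ℝ := Real.sqrt 12 ^ (d + 1) * (Real.sqrt 6 * (1 + 8 * (d + 1 : ℕ))) with hK
  set C1 : ℝ := (3 * π) ^ (1 - (-1 : ℝ)) * (3 : ℝ) ^ (d + 1) * aliasConst (d + 1) (-1) with hC1
  set C2 : ℝ := (3 * π) ^ (1 - (-2 : ℝ)) * (3 : ℝ) ^ (d + 1) * aliasConst (d + 1) (-2) with hC2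
  set E : ℝ := Real.exp ((d + 1) * η) with hE
  have hN : (0 : ℝ) < N := by exact_mod_cast Nat.pos_of_ne_zero (NeZero.ne N)
  have hB0 : 0 ≤ B := by positivity
  have hK0 : 0 ≤ K := by positivity
  have hE0 : 0 ≤ E := (Real.exp_pos _).le
  -- (U1)+A: the arrow vector of the column and the sharp ℓ² bounds
  obtain ⟨c, hx, hAmp, hφ, hc⟩ := column_apriori hr hr0 p hA0 hdet hU hA l
  -- border data in E3A2's currency
  set Φ : ℝ := r0 ^ 2 / (N : ℝ) ^ 3 * A * ((N : ℝ) ^ (d + 1 + 1))⁻¹ with hΦ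
  set Cc : ℝ := r0 ^ 3 / (N : ℝ) ^ 3 * A * ((N : ℝ) ^ (d + 1 + 1))⁻¹ with hCc
  have hΦ' : ∀ κ', ‖v (Sum.inr (Sum.inr κ'))‖ ≤ Φ := fun κ' => hφ κ'
  -- the point value as the plane-wave synthesis of the amplitudes
  have hsyn : v (Sum.inl (κ, z)) = ∑ m : TorusSite (d + 1) N, ampA p v m κ * pw (kFine p m) (repZ z) := boxData_inl_eq_sum p v κ z
  -- termwise bounds
  have hterm0 : ‖ampA p v 0 κ * pw (kFine p (0 : TorusSite (d + 1) N)) (repZ z)‖ ≤ E * B := by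
    rw [norm_mul]
    calc ‖ampA p v 0 κ‖ * ‖pw (kFine p (0 : TorusSite (d + 1) N)) (repZ z)‖ ≤ B * E :=
          mul_le_mul (hAmp 0 κ) (norm_pw_repZ_le him (0 : TorusSite (d + 1) N) z) (norm_nonneg _) hB0
      _ = E * B := mul_comm _ _
  have hterm : ∀ m : TorusSite (d + 1) N, m ≠ 0 →
      ‖ampA p v m κ * pw (kFine p m) (repZ z)‖ ≤ E * (B * K * (r0 ^ 2 * pointWeight (-1) (srep m) + r0 ^ 3 * pointWeight (-2) (srep m))) := by
    intro m hm
    rw [norm_mul]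
    have hA2 := norm_Asol_border_le (D := d + 1) hre him hη hη4 hηD hm (φ := fun κ' => v (Sum.inr (Sum.inr κ'))) (c := c) hΦ' hc κ
    have hLm : lapSym (kFine p m) ≠ 0 := by
      have hpos := FineReadoutAlias.lapR_pos (N := N) (p := p) hre hm
      have hhalf := FineReadoutAlias.half_lapR_le_norm_LAl (N := N) hre him hη hηD hm
      intro h0
      have : ‖LAl N p m‖ = 0 := by rw [show LAl N p m = lapSym (kFine p m) from rfl, h0, norm_zero]
      linarith
    rw [← ampA_eq_Asol hx m hLm] at hA2
    have hF : 0 < Fsup m := lt_of_lt_of_le one_pos (one_le_Fsup hm)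
    have hW : 0 ≤ ∏ i, wfold m i := Finset.prod_nonneg fun i _ => wfold_nonneg m i
    -- rewrite E3A2's bound in the `pointWeight` currency
    have hre' : (Real.sqrt 12 ^ (d + 1) * (Real.sqrt 6 * (1 + 8 * (d + 1 : ℕ)))) * (N : ℝ) ^ 3 * (Φ / Fsup m ^ 2 + Cc / Fsup m ^ 3) * ∏ i, wfold m i
        = B * K * (r0 ^ 2 * pointWeight (-1) (srep m) + r0 ^ 3 * pointWeight (-2) (srep m)) := by
      rw [← pointWeight_neg_one_eq hm, ← pointWeight_neg_two_eq hm, hΦ, hCc, hB, hK]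
      field_simp
    rw [hre'] at hA2
    calc ‖ampA p v m κ‖ * ‖pw (kFine p m) (repZ z)‖
        ≤ (B * K * (r0 ^ 2 * pointWeight (-1) (srep m) + r0 ^ 3 * pointWeight (-2) (srep m))) * E :=
          mul_le_mul hA2 (norm_pw_repZ_le him m z) (norm_nonneg _) (by
            have h1 := AliasPointSum.pointWeight_nonneg (-1) (srep m)
            have h2 := AliasPointSum.pointWeight_nonneg (-2) (srep m)
            positivity)
      _ = E * (B * K * (r0 ^ 2 * pointWeight (-1) (srep m) + r0 ^ 3 * pointWeight (-2) (srep m))) := mul_comm _ _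
  -- sum: split off the zero alias
  have hsplit : ‖v (Sum.inl (κ, z))‖ ≤ E * B + ∑ m ∈ (Finset.univ : Finset (TorusSite (d + 1) N)).filter (fun m => m ≠ 0),
      E * (B * K * (r0 ^ 2 * pointWeight (-1) (srep m) + r0 ^ 3 * pointWeight (-2) (srep m))) := by
    rw [hsyn]
    refine (norm_sum_le _ _).trans ?_
    rw [← Finset.add_sum_erase _ _ (Finset.mem_univ (0 : TorusSite (d + 1) N))]
    refine add_le_add hterm0 ?_
    have hset : (Finset.univ : Finset (TorusSite (d + 1) N)).erase 0 = Finset.univ.filter (fun m => m ≠ 0) := by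
      ext m; simp [Finset.mem_erase]
    rw [hset]
    exact Finset.sum_le_sum fun m hm => hterm m (Finset.mem_filter.1 hm).2
  -- King's window-free sums
  have hS1 := sum_pointWeight_srep_le (D := d + 1) (N := N) (Nat.succ_pos d) (α := -1) (by norm_num)
  have hS2 := sum_pointWeight_srep_le (D := d + 1) (N := N) (Nat.succ_pos d) (α := -2) (by norm_num)
  have hsum : ∑ m ∈ (Finset.univ : Finset (TorusSite (d + 1) N)).filter (fun m => m ≠ 0),
      E * (B * K * (r0 ^ 2 * pointWeight (-1) (srep m) + r0 ^ 3 * pointWeight (-2) (srep m)))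
      ≤ E * (B * K * (r0 ^ 2 * C1 + r0 ^ 3 * C2)) := by
    rw [← Finset.mul_sum, ← Finset.mul_sum, Finset.sum_add_distrib, ← Finset.mul_sum, ← Finset.mul_sum]
    apply mul_le_mul_of_nonneg_left _ hE0
    apply mul_le_mul_of_nonneg_left _ (mul_nonneg hB0 hK0)
    exact add_le_add (mul_le_mul_of_nonneg_left hS1 (by positivity)) (mul_le_mul_of_nonneg_left hS2 (by positivity))
  calc ‖fibInv N (Sum.inl (κ, z)) (Sum.inr (Sum.inr l)) p‖ = ‖v (Sum.inl (κ, z))‖ := rfl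
    _ ≤ E * B + E * (B * K * (r0 ^ 2 * C1 + r0 ^ 3 * C2)) := hsplit.trans (add_le_add le_rfl hsum)
    _ = E * A * ((N : ℝ) ^ (d + 1 + 1))⁻¹ * (1 + K * (r0 ^ 2 * C1 + r0 ^ 3 * C2)) := by rw [hB]; ring

end Summit.QuantumFields.BalabanUV.Beta.GAN24.FineReadoutSum

end
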